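import Literature.Analysis.FluidPDE.StatisticalSolutionEnergyEq
import Literature.Analysis.FluidPDE.LerayHopfTimeSliceTorus
import Literature.Analysis.FluidPDE.ScalarEnergyCalculus
import HarnessLib

/-!
# The truncated energy balance of the difference of two Leray–Hopf solutions on `T^d`

Analysis/FluidPDE support file for the discharge of
`Literature.Analysis.FluidPDE.lions_prodi_difference_ineq_torus2` (the energy inequality for the
difference of two Leray–Hopf solutions on `𝕋²`; Constantin–Foias 1988, proof of Thm. 10.1,
(10.3)–(10.5): "`½ d/dt |w|² + ν‖w‖² + b(w,u₂,w) = 0` … takes place almost for every `t`";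
Temam 1984, Ch. III, Thm. 3.2 and Lemma 1.2). The printed proof tests the equation for
`w = u - v` with `w`; on the weak level this is done **mode by mode** on the real Stokes
eigenfields `g_{kjc}` (`Torus.frameField`, the Galerkin frame of `StatisticalSolutionEnergyEq`):
the two time-sliced weak formulations (`Torus.IsLerayHopfOn.integral_inner_eq_add_setIntegral`;
the force cancels in the difference) make `s ↦ (w(s), g)` an integral `∫₀ˢ G` with `G ∈ L¹`, whose
square is `2∫₀ᵗ G (w, g)` (`sq_sub_sq_eq_setIntegral_of_sub_eq_setIntegral`), and the sum over
`0 < |k| ≤ N` is the balance of the Fourier truncation `P_N w`. Main result, valid in every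
dimension and for every `N` and `t ∈ (0, T]`:

* `Torus.IsLerayHopfOn.truncated_difference_balance` —
  `∫ ‖P_N w(t)‖² + 2ν ∫₀ᵗ ‖∇P_N w‖₂² = 2 ∫₀ᵗ [∫⟪u,(u·∇)P_N w⟫ - ∫⟪v,(v·∇)P_N w⟫]`.

(The two-dimensional step — the limit `N → ∞` with Ladyzhenskaya's inequality — is done in the
discharge file.) Supporting material:

* the frame **on functions** (the accepted frame lemmas are stated for elements of the energy
  space `H ⊆ L²`): `Torus.sum_frame_smul_eq_fourierTruncate`, `Torus.sum_frame_sq_eq`,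
  `Torus.sum_frame_weighted_sq_eq` — for `w ∈ L²` weakly divergence free with `ŵ(0) = 0`:
  `∑ (w, g_{kjc}) g_{kjc} = P_N w`, `∑ (w, g_{kjc})² = ∫ ‖P_N w‖²`,
  `∑ 4π²|k|² (w, g_{kjc})² = ‖∇P_N w‖₂²`; `Torus.laplacian_frameField` (`Δg = -4π²|k|²g`);
* `Torus.integral_inner_convect_sum_smul`, `Torus.integral_inner_convect_frame_sum` — linearity of
  `Ψ ↦ ∫ ⟪a, (a·∇)Ψ⟫` over finite sums;
* slices: `Torus.IsLerayHopfOn.isWeaklyDivFree_of_mem_Ioc` (weakly divergence free at *every*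
  `t ∈ (0, T]`), `Torus.IsLerayHopfOn.integral_inner_const_eq` and
  `Torus.IsLerayHopfOn.mFourierCoeff_zero_sub_eq_zero` (the mean `û(t)(0)` is determined by the
  data, so `ŵ(t)(0) = 0`), integrability of the slice functionals
  (`…integrableOn_integral_inner_convect`, `…pairing_sub_bdd`, …);
* `Torus.IsLerayHopfOn.sq_frame_pairing_sub_eq` — the balance of one frame coordinate.

## References

* P. Constantin, C. Foias, *Navier–Stokes Equations*, Chicago 1988, Ch. 4 (4.13), Thm. 10.1 and
  its proof, (10.3)–(10.5).
* R. Temam, *Navier–Stokes Equations*, 3rd ed., North-Holland 1984, Ch. III §1, Lemma 1.2,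
  (1.25), Thm. 3.2.
-/

open MeasureTheory
open MeasureTheory Set Filter Topology UnitAddTorus Function
open scoped ENNReal NNReal InnerProductSpace

noncomputable section

namespace Literature.Analysis.FluidPDE

open FunctionSpaces

variable {d : Type*} [Fintype d] [DecidableEq d]

/-! ### The frame on functions -/

/-- **The frame reproduces the truncation**, function form: for `w ∈ L²(T^d; ℝ^d)` weakly
divergence free with vanishing mean coefficient, `∑_{0<|k|≤N} ∑ⱼ ∑_c (w, g_{kjc}) g_{kjc} = P_N w`
pointwise (as `Torus.sum_integral_inner_frameField_smul`, whose proof uses only these three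
properties of the energy-space element). [folklore] -/
theorem Torus.sum_frame_smul_eq_fourierTruncate {w : UnitAddTorus d → EuclideanSpace ℝ d}
    (hw : MemLp w 2 volume) (hdiv : Torus.IsWeaklyDivFree w)
    (h0 : mFourierCoeff (EuclideanSpace.complexify ∘ w) 0 = 0) (N : ℕ) (x : UnitAddTorus d) :
    ∑ k ∈ Torus.freqBall₀ N, ∑ j, ∑ c, (∫ y, ⟪w y, Torus.frameField k j c y⟫_ℝ) • Torus.frameField k j c x =
      Torus.fourierTruncate N w x := by
  have hint : Integrable w volume := hw.integrable one_le_two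
  have key : ∀ k ∈ Torus.freqBall₀ N, ∑ j, ∑ c,
      (∫ y, ⟪w y, Torus.frameField k j c y⟫_ℝ) • Torus.frameField k j c x =
      EuclideanSpace.realPart (mFourier k x • mFourierCoeff (EuclideanSpace.complexify ∘ w) k) := by
    intro k _
    simp_rw [Torus.frameField, Torus.integral_inner_realTrigPoly_singleton hint, Torus.realTrigPoly_singleton_apply,
      Torus.smul_realPart_mFourier_smul, ← map_sum, ← Finset.smul_sum]
    rw [Torus.sum_sum_re_inner_frameVec_smul (hdiv.sum_mul_mFourierCoeff_eq_zero hw k)]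
  rw [Finset.sum_congr rfl key, Torus.freqBall₀, Finset.sum_erase _ (by rw [h0, smul_zero, map_zero]),
    Torus.fourierTruncate_eq, Torus.realTrigPoly_apply_eq_sum]

/-- **Parseval identity of the frame**, function form: `∑ (w, g_{kjc})² = ∫ ‖P_N w‖²`. [folklore] -/
theorem Torus.sum_frame_sq_eq {w : UnitAddTorus d → EuclideanSpace ℝ d}
    (hw : MemLp w 2 volume) (hdiv : Torus.IsWeaklyDivFree w)
    (h0 : mFourierCoeff (EuclideanSpace.complexify ∘ w) 0 = 0) (N : ℕ) :
    ∑ k ∈ Torus.freqBall₀ N, ∑ j, ∑ c, (∫ y, ⟪w y, Torus.frameField k j c y⟫_ℝ) ^ 2 =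
      ∫ y, ‖Torus.fourierTruncate N w y‖ ^ 2 := by
  have hint : Integrable w volume := hw.integrable one_le_two
  have key : ∀ k ∈ Torus.freqBall₀ N, ∑ j, ∑ c, (∫ y, ⟪w y, Torus.frameField k j c y⟫_ℝ) ^ 2 =
      ‖mFourierCoeff (EuclideanSpace.complexify ∘ w) k‖ ^ 2 := by
    intro k _
    simp_rw [Torus.frameField, Torus.integral_inner_realTrigPoly_singleton hint]
    exact Torus.sum_sum_sq_re_inner_frameVec (hdiv.sum_mul_mFourierCoeff_eq_zero hw k)
  rw [Finset.sum_congr rfl key, Torus.freqBall₀, Finset.sum_erase _ (by rw [h0, norm_zero, zero_pow two_ne_zero]),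
    Torus.integral_norm_sq_fourierTruncate hint]

/-- **Weighted Parseval identity of the frame**: `∑ 4π²|k|² (w, g_{kjc})² = ‖∇P_N w‖₂²` (the
spectral dissipation `eGradNormSq (P_N w)`, a finite sum). [folklore] -/
theorem Torus.sum_frame_weighted_sq_eq {w : UnitAddTorus d → EuclideanSpace ℝ d}
    (hw : MemLp w 2 volume) (hdiv : Torus.IsWeaklyDivFree w)
    (h0 : mFourierCoeff (EuclideanSpace.complexify ∘ w) 0 = 0) (N : ℕ) :
    ∑ k ∈ Torus.freqBall₀ N, ∑ j, ∑ c,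
        4 * Real.pi ^ 2 * Torus.freqNormSq k * (∫ y, ⟪w y, Torus.frameField k j c y⟫_ℝ) ^ 2 =
      (Torus.eGradNormSq (Torus.fourierTruncate N w)).toReal := by
  have hint : Integrable w volume := hw.integrable one_le_two
  have key : ∀ k ∈ Torus.freqBall₀ N, ∑ j, ∑ c,
      4 * Real.pi ^ 2 * Torus.freqNormSq k * (∫ y, ⟪w y, Torus.frameField k j c y⟫_ℝ) ^ 2 =
      4 * Real.pi ^ 2 * Torus.freqNormSq k * ‖mFourierCoeff (EuclideanSpace.complexify ∘ w) k‖ ^ 2 := by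
    intro k _
    rw [← Finset.sum_congr rfl fun j _ => (Finset.mul_sum _ _ _), ← Finset.mul_sum]
    congr 1
    simp_rw [Torus.frameField, Torus.integral_inner_realTrigPoly_singleton hint]
    exact Torus.sum_sum_sq_re_inner_frameVec (hdiv.sum_mul_mFourierCoeff_eq_zero hw k)
  rw [Finset.sum_congr rfl key, Torus.freqBall₀, Finset.sum_erase _ (by rw [h0, norm_zero, zero_pow two_ne_zero, mul_zero]),
    Torus.eGradNormSq_fourierTruncate_eq_sum hint, ENNReal.toReal_mul, ENNReal.toReal_ofReal (by positivity),
    ENNReal.toReal_sum (fun k _ => ENNReal.mul_ne_top ENNReal.ofReal_ne_top (ENNReal.pow_ne_top enorm_ne_top)),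
    Finset.mul_sum]
  refine Finset.sum_congr rfl fun k _ => ?_
  rw [ENNReal.toReal_mul, ENNReal.toReal_ofReal (Torus.freqNormSq_nonneg k), ← ofReal_norm,
    ← ENNReal.ofReal_pow (norm_nonneg _), ENNReal.toReal_ofReal (sq_nonneg _)]
  ring

/-- **Frame fields are Stokes eigenfields**: `Δ g_{kjc} = -4π²|k|² g_{kjc}`. [folklore] -/
theorem Torus.laplacian_frameField (k : d → ℤ) (j : d) (c : Bool) (x : UnitAddTorus d) :
    Torus.laplacian (Torus.frameField k j c) x = -(4 * Real.pi ^ 2 * Torus.freqNormSq k) • Torus.frameField k j c x :=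
  Torus.laplacian_realTrigPoly_singleton k _ x

/-- Frame fields are smooth. [folklore] -/
theorem Torus.isSmooth_frameField (k : d → ℤ) (j : d) (c : Bool) : Torus.IsSmooth (Torus.frameField k j c) :=
  Torus.isSmooth_realTrigPoly _ _

/-! ### Linearity of the convective pairing in the test field -/

omit [DecidableEq d] in
/-- Finite linear combinations of `C¹` fields are `C¹`. [folklore] -/
theorem Torus.isContDiff_sum_smul {ι : Type*} (s : Finset ι) {Ψ : ι → UnitAddTorus d → EuclideanSpace ℝ d}
    (hΨ : ∀ i, Torus.IsContDiff 1 (Ψ i)) (c : ι → ℝ) :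
    Torus.IsContDiff 1 (fun y => ∑ i ∈ s, c i • Ψ i y) := by
  have h : Torus.lift (fun y => ∑ i ∈ s, c i • Ψ i y) = fun z => ∑ i ∈ s, c i • Torus.lift (Ψ i) z := rfl
  show ContDiff ℝ 1 (Torus.lift (fun y => ∑ i ∈ s, c i • Ψ i y))
  rw [h]
  exact ContDiff.sum fun i _ => (show ContDiff ℝ 1 (Torus.lift (Ψ i)) from hΨ i).const_smul (c i)

omit [DecidableEq d] in
/-- `(a·∇)(∑ᵢ cᵢ Ψᵢ) = ∑ᵢ cᵢ (a·∇)Ψᵢ` pointwise, for `C¹` fields `Ψᵢ`. [folklore] -/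
theorem Torus.convect_sum_smul {ι : Type*} (s : Finset ι) (a : UnitAddTorus d → EuclideanSpace ℝ d)
    {Ψ : ι → UnitAddTorus d → EuclideanSpace ℝ d} (hΨ : ∀ i, Torus.IsContDiff 1 (Ψ i)) (c : ι → ℝ)
    (x : UnitAddTorus d) :
    Torus.convect a (fun y => ∑ i ∈ s, c i • Ψ i y) x = ∑ i ∈ s, c i • Torus.convect a (Ψ i) x := by
  classical
  induction s using Finset.induction_on with
  | empty =>
    simp only [Finset.sum_empty]
    rw [Torus.convect, show (fun _ : UnitAddTorus d => (0 : EuclideanSpace ℝ d)) = 0 from rfl]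
    unfold Torus.fderiv
    rw [show Torus.liftAt (0 : UnitAddTorus d → EuclideanSpace ℝ d) x = 0 from rfl, fderiv_zero]
    rfl
  | insert i s hi ih =>
    simp only [Finset.sum_insert hi]
    have h1 : Torus.IsContDiff 1 (c i • Ψ i) := (hΨ i).smul (c i)
    have h2 : Torus.IsContDiff 1 (fun y => ∑ i ∈ s, c i • Ψ i y) := Torus.isContDiff_sum_smul s hΨ c
    rw [Torus.convect, show (fun y => c i • Ψ i y + ∑ i ∈ s, c i • Ψ i y) =
      (c i • Ψ i) + fun y => ∑ i ∈ s, c i • Ψ i y from rfl, Torus.fderiv_add h1 h2,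
      _root_.add_apply, Torus.fderiv_const_smul (hΨ i)]
    rw [← ih]
    rfl

/-- **Linearity of `Ψ ↦ ∫ ⟪a, (a·∇)Ψ⟫` over finite sums** (`a ∈ L²`, `Ψᵢ` smooth). [folklore] -/
theorem Torus.integral_inner_convect_sum_smul {ι : Type*} (s : Finset ι) {a : UnitAddTorus d → EuclideanSpace ℝ d}
    (ha : MemLp a 2 volume) {Ψ : ι → UnitAddTorus d → EuclideanSpace ℝ d} (hΨ : ∀ i, Torus.IsSmooth (Ψ i)) (c : ι → ℝ) :
    ∫ x, ⟪a x, Torus.convect a (fun y => ∑ i ∈ s, c i • Ψ i y) x⟫_ℝ =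
      ∑ i ∈ s, c i * ∫ x, ⟪a x, Torus.convect a (Ψ i) x⟫_ℝ := by
  simp_rw [Torus.convect_sum_smul s a (fun i => (hΨ i).isContDiff (by simp)) c, inner_sum, inner_smul_right]
  rw [integral_finsetSum _ fun i _ => (Torus.integrable_inner_convect_self ha (hΨ i)).const_mul (c i)]
  exact Finset.sum_congr rfl fun i _ => integral_const_mul _ _

/-! ### Slices of Leray–Hopf solutions: divergence and mean -/

variable {T ν : ℝ} {f u v : ℝ → UnitAddTorus d → EuclideanSpace ℝ d} {u₀ : UnitAddTorus d → EuclideanSpace ℝ d}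

/-- **Weak divergence-freeness at every positive time**: a Leray–Hopf solution on `T^d` is
weakly divergence free at *every* `t ∈ (0, T]` (the definition asks it for a.e. `t`; the pairing
`t ↦ ∫ ⟪u(t), ∇θ⟫` is continuous on `(0, T]` by weak `L²`-continuity and vanishes a.e., hence
everywhere, `eq_zero_of_continuousOn_Ioc_of_ae_eq_zero`). [folklore] -/
theorem Torus.IsLerayHopfOn.isWeaklyDivFree_of_mem_Ioc (hu : Torus.IsLerayHopfOn T ν f u₀ u) {t : ℝ}
    (ht : t ∈ Ioc 0 T) : Torus.IsWeaklyDivFree (u t) := by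
  intro θ hθ
  have hcont : ContinuousOn (fun s => ∫ x, ⟪u s x, Torus.gradient θ x⟫_ℝ) (Ioc 0 T) :=
    (hu.weak_continuous (Torus.gradient θ) (hθ.gradient.memLp 2)).1
  have hae : ∀ᵐ s ∂(volume.restrict (Ioo 0 T)), (∫ x, ⟪u s x, Torus.gradient θ x⟫_ℝ) = 0 := by
    obtain ⟨-, -, hdiv, -⟩ := hu.weak
    filter_upwards [hdiv] with s hs
    exact hs θ hθ
  exact eq_zero_of_continuousOn_Ioc_of_ae_eq_zero hcont hae ht

omit [Fintype d] in
/-- Partial derivatives of a constant field vanish. [folklore] -/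
theorem Torus.partialDeriv_const_field {F : Type*} [NormedAddCommGroup F] [NormedSpace ℝ F] (e : F) (i : d) :
    Torus.partialDeriv i (fun _ : UnitAddTorus d => e) = fun _ => 0 := by
  funext x
  simp [Torus.partialDeriv, Torus.lineDeriv]

/-- The constant field is divergence free. [folklore] -/
theorem Torus.isDivFree_const_field (e : EuclideanSpace ℝ d) : Torus.IsDivFree (fun _ : UnitAddTorus d => e) := by
  intro x
  rw [Torus.divergence]
  exact Finset.sum_eq_zero fun i _ => by
    rw [show (fun y : UnitAddTorus d => (e : EuclideanSpace ℝ d) i) = fun _ => e i from rfl, Torus.partialDeriv_const_field]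

omit [DecidableEq d] in
/-- The convective derivative of a constant field vanishes. [folklore] -/
theorem Torus.convect_const_field (a : UnitAddTorus d → EuclideanSpace ℝ d) (e : EuclideanSpace ℝ d) (x : UnitAddTorus d) :
    Torus.convect a (fun _ : UnitAddTorus d => e) x = 0 := by
  rw [Torus.convect]
  unfold Torus.fderiv
  rw [show Torus.liftAt (fun _ : UnitAddTorus d => e) x = fun _ => e from rfl]
  simp

/-- The Laplacian of a constant field vanishes. [folklore] -/
theorem Torus.laplacian_const_field (e : EuclideanSpace ℝ d) (x : UnitAddTorus d) :
    Torus.laplacian (fun _ : UnitAddTorus d => e) x = 0 := by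
  rw [Torus.laplacian_eq_sum_partialDeriv_partialDeriv (Torus.isSmooth_const e)]
  refine Finset.sum_eq_zero fun i _ => ?_
  rw [Torus.partialDeriv_const_field e i, Torus.partialDeriv_const_field (0 : EuclideanSpace ℝ d) i]

omit [DecidableEq d] in
/-- The zeroth Fourier coefficient of a field with zero mean vanishes. [folklore] -/
theorem Torus.mFourierCoeff_complexify_zero_of_integral_eq_zero {w : UnitAddTorus d → EuclideanSpace ℝ d}
    (hw : Integrable w volume) (h : ∫ x, w x = 0) :
    mFourierCoeff (EuclideanSpace.complexify ∘ w) 0 = 0 := by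
  have h1 : (fun x : UnitAddTorus d => mFourier (-(0 : d → ℤ)) x • (EuclideanSpace.complexify ∘ w) x) =
      fun x => EuclideanSpace.complexify (w x) := by
    funext x
    rw [neg_zero, Function.comp_apply]
    have : mFourier (0 : d → ℤ) x = 1 := by simp [mFourier]
    rw [this, one_smul]
  rw [Torus.mFourierCoeff_eq_integral_volume, h1,
    show (fun x => EuclideanSpace.complexify (w x)) = fun x => EuclideanSpace.complexify.toContinuousLinearMap (w x) from rfl,
    ContinuousLinearMap.integral_comp_comm _ hw, h, map_zero]

/-- **The mean of a Leray–Hopf solution is determined by the data**: testing the time-sliced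
weak formulation with a constant field `e`,
`∫ ⟪u(t), e⟫ = ∫ ⟪u₀, e⟫ + ∫₀ᵗ ∫ ⟪f, e⟫` for `t ∈ (0, T]`. [folklore] -/
theorem Torus.IsLerayHopfOn.integral_inner_const_eq (hu : Torus.IsLerayHopfOn T ν f u₀ u) (hT : 0 < T)
    (hfm : AEStronglyMeasurable (Torus.stLift f) (volume.restrict (Ioo 0 T ×ˢ univ)))
    (hf₂ : ∫⁻ t in Ioo 0 T, ∫⁻ x, ‖f t x‖ₑ ^ 2 < ⊤) (e : EuclideanSpace ℝ d) {t : ℝ} (ht : t ∈ Ioc 0 T) :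
    ∫ x, ⟪u t x, e⟫_ℝ = (∫ x, ⟪u₀ x, e⟫_ℝ) + ∫ s in Ioc 0 t, ∫ x, ⟪f s x, e⟫_ℝ := by
  rw [hu.integral_inner_eq_add_setIntegral hT hfm hf₂ (Torus.isSmooth_const e) (Torus.isDivFree_const_field e) ht]
  congr 1
  refine setIntegral_congr_fun measurableSet_Ioc fun s _ => integral_congr_ae (ae_of_all _ fun x => ?_)
  simp only [Torus.convect_const_field, Torus.laplacian_const_field, inner_zero_right, mul_zero, zero_add]

/-- **Two Leray–Hopf solutions with the same data have the same mean**: the zeroth Fourier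
coefficient of `u(t) - v(t)` vanishes for `t ∈ (0, T]`. [folklore] -/
theorem Torus.IsLerayHopfOn.mFourierCoeff_zero_sub_eq_zero (hu : Torus.IsLerayHopfOn T ν f u₀ u)
    (hv : Torus.IsLerayHopfOn T ν f u₀ v) (hT : 0 < T)
    (hfm : AEStronglyMeasurable (Torus.stLift f) (volume.restrict (Ioo 0 T ×ˢ univ)))
    (hf₂ : ∫⁻ t in Ioo 0 T, ∫⁻ x, ‖f t x‖ₑ ^ 2 < ⊤) {t : ℝ} (ht : t ∈ Ioc 0 T) :
    mFourierCoeff (EuclideanSpace.complexify ∘ (u t - v t)) 0 = 0 := by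
  have hut : Integrable (u t) volume := (hu.memLp t (Ioc_subset_Icc_self ht)).integrable one_le_two
  have hvt : Integrable (v t) volume := (hv.memLp t (Ioc_subset_Icc_self ht)).integrable one_le_two
  have hmean : ∫ x, (u t - v t) x = 0 := by
    rw [integral_sub' hut hvt, sub_eq_zero]
    -- equality of all pairings with constant vectors
    refine ext_inner_left ℝ fun e => ?_
    rw [← integral_inner hut e, ← integral_inner hvt e,
      show (∫ x, ⟪e, u t x⟫_ℝ) = ∫ x, ⟪u t x, e⟫_ℝ from integral_congr_ae (ae_of_all _ fun x => real_inner_comm _ _),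
      show (∫ x, ⟪e, v t x⟫_ℝ) = ∫ x, ⟪v t x, e⟫_ℝ from integral_congr_ae (ae_of_all _ fun x => real_inner_comm _ _),
      hu.integral_inner_const_eq hT hfm hf₂ e ht, hv.integral_inner_const_eq hT hfm hf₂ e ht]
  exact Torus.mFourierCoeff_complexify_zero_of_integral_eq_zero (hut.sub hvt) hmean

/-! ### Integrability of the slice functionals -/

/-- The trilinear slice functional `s ↦ ∫ ⟪u(s), (u(s)·∇)Ψ⟫` of a Leray–Hopf solution against a
smooth field is integrable on `(0, T)` (jointly measurable integrand; bounded a.e. by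
`(sup ∑ᵢ‖∂ᵢΨ‖) ∫ ‖u(s)‖²`). [folklore] -/
theorem Torus.IsLerayHopfOn.integrableOn_integral_inner_convect (hu : Torus.IsLerayHopfOn T ν f u₀ u)
    {Ψ : UnitAddTorus d → EuclideanSpace ℝ d} (hΨ : Torus.IsSmooth Ψ) :
    IntegrableOn (fun s => ∫ x, ⟪u s x, Torus.convect (u s) Ψ x⟫_ℝ) (Ioo 0 T) := by
  obtain ⟨C, -, hC⟩ := hu.exists_integral_norm_sq_le
  obtain ⟨D, hD0, hD⟩ := Torus.exists_sum_norm_partialDeriv_le hΨ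
  have hu' := hu.aestronglyMeasurable_uncurry
  have hconv : (fun p : ℝ × UnitAddTorus d => Torus.convect (u p.1) Ψ p.2) =
      fun p => ∑ i, (uncurry u p) i • Torus.partialDeriv i Ψ p.2 := by
    funext p
    exact Torus.fderiv_apply_eq_sum_partialDeriv (hΨ.isContDiff (by simp)) _ _
  have hconvm : AEStronglyMeasurable (fun p : ℝ × UnitAddTorus d => Torus.convect (u p.1) Ψ p.2)
      ((volume.restrict (Ioo 0 T)).prod volume) := by
    rw [hconv]
    exact Finset.aestronglyMeasurable_fun_sum _ fun i _ =>
      ((EuclideanSpace.proj (𝕜 := ℝ) i).continuous.comp_aestronglyMeasurable hu').smul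
        ((hΨ.partialDeriv i).continuous.comp continuous_snd).aestronglyMeasurable
  have h1 : AEStronglyMeasurable (fun p : ℝ × UnitAddTorus d => ⟪uncurry u p, Torus.convect (u p.1) Ψ p.2⟫_ℝ)
      ((volume.restrict (Ioo 0 T)).prod volume) := hu'.inner hconvm
  have hmeas : AEStronglyMeasurable (fun s => ∫ x, ⟪u s x, Torus.convect (u s) Ψ x⟫_ℝ)
      (volume.restrict (Ioo 0 T)) := h1.integral_prod_right'
  refine ⟨hmeas, HasFiniteIntegral.of_bounded (C := D * C) ?_⟩
  filter_upwards [hC, ae_restrict_mem measurableSet_Ioo] with s hs hsI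
  have hmem : MemLp (u s) 2 volume := hu.memLp s (Ioo_subset_Icc_self hsI)
  rw [Real.norm_eq_abs]
  exact (Torus.abs_integral_inner_convect_self_le hmem hΨ hD).trans (mul_le_mul_of_nonneg_left hs hD0)

/-- The pairing `s ↦ ⟨u(s), a⟩` with a continuous field is a.e. bounded on `(0, T)`:
`|⟨u(s), a⟩| ≤ (sup ‖a‖) · ½(1 + C)`. [folklore] -/
theorem Torus.IsLerayHopfOn.exists_ae_abs_integral_inner_le (hu : Torus.IsLerayHopfOn T ν f u₀ u)
    {a : UnitAddTorus d → EuclideanSpace ℝ d} (ha : Continuous a) :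
    ∃ K : ℝ, ∀ᵐ s ∂(volume.restrict (Ioo 0 T)), |∫ x, ⟪u s x, a x⟫_ℝ| ≤ K := by
  obtain ⟨C, -, hC⟩ := hu.exists_integral_norm_sq_le
  obtain ⟨K, hK0, hK⟩ := Torus.exists_nonneg_forall_norm_le_of_continuous ha
  refine ⟨K * (2⁻¹ * (1 + C)), ?_⟩
  filter_upwards [hC, ae_restrict_mem measurableSet_Ioo] with s hs hsI
  have hmem : MemLp (u s) 2 volume := hu.memLp s (Ioo_subset_Icc_self hsI)
  refine (Torus.abs_integral_inner_le_of_norm_le (hmem.integrable one_le_two) hK).trans ?_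
  refine mul_le_mul_of_nonneg_left ((Torus.integral_norm_le_of_memLp_two hmem).trans ?_) hK0
  gcongr

omit [DecidableEq d] in
/-- Force slices are integrable for a.e. time when `f ∈ L²((0,T) × T^d)`. [folklore] -/
theorem Torus.ae_integrable_force_slice
    (hfm : AEStronglyMeasurable (Torus.stLift f) (volume.restrict (Ioo 0 T ×ˢ univ)))
    (hf₂ : ∫⁻ t in Ioo 0 T, ∫⁻ x, ‖f t x‖ₑ ^ 2 < ⊤) :
    ∀ᵐ s ∂(volume.restrict (Ioo 0 T)), Integrable (f s) volume := by
  have hf' : AEStronglyMeasurable (uncurry f) ((volume.restrict (Ioo 0 T)).prod volume) := by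
    have h := Torus.aestronglyMeasurable_uncurry_of_stLift_restrict hfm
    rwa [Measure.volume_eq_prod, ← Measure.prod_restrict, Measure.restrict_univ] at h
  have hmeas : ∀ᵐ s ∂(volume.restrict (Ioo 0 T)), AEStronglyMeasurable (f s) volume := hf'.prodMk_left
  have hint : AEMeasurable (fun s => ∫⁻ x, ‖f s x‖ₑ ^ 2) (volume.restrict (Ioo 0 T)) :=
    (hf'.aemeasurable.enorm.pow_const 2).lintegral_prod_right'
  have hfin : ∀ᵐ s ∂(volume.restrict (Ioo 0 T)), ∫⁻ x, ‖f s x‖ₑ ^ 2 < ⊤ := ae_lt_top' hint hf₂.ne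
  haveI : IsFiniteMeasure (volume : Measure (UnitAddTorus d)) := inferInstance
  filter_upwards [hmeas, hfin] with s hs hs'
  have hmem : MemLp (f s) 2 volume :=
    ⟨hs, (eLpNorm_lt_top_iff_lintegral_rpow_enorm_lt_top two_ne_zero ENNReal.ofNat_ne_top).2
      (by simpa only [ENNReal.toReal_ofNat, ENNReal.rpow_two] using hs')⟩
  exact hmem.integrable one_le_two

omit [Fintype d] [DecidableEq d] in
/-- Restriction of integrability from `(0, T)` to `(0, τ]`, `τ ≤ T`. [folklore] -/
theorem integrableOn_Ioc_of_integrableOn_Ioo {F : ℝ → ℝ} (hF : IntegrableOn F (Ioo 0 T)) {τ : ℝ} (hτ : τ ≤ T) :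
    IntegrableOn F (Ioc 0 τ) :=
  ((hF.mono_set (Ioo_subset_Ioo le_rfl hτ)).congr_set_ae Ioo_ae_eq_Ioc.symm)

/-! ### The pairing of the difference with a continuous field -/

/-- `∫ ⟪u(s) - v(s), a⟫ = ⟨u(s), a⟩ - ⟨v(s), a⟩` for `s ∈ [0, T]`. [folklore] -/
theorem Torus.IsLerayHopfOn.integral_inner_sub_left_eq (hu : Torus.IsLerayHopfOn T ν f u₀ u)
    (hv : Torus.IsLerayHopfOn T ν f u₀ v) {a : UnitAddTorus d → EuclideanSpace ℝ d} (ha : Continuous a)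
    {s : ℝ} (hs : s ∈ Icc 0 T) :
    ∫ x, ⟪u s x - v s x, a x⟫_ℝ = (∫ x, ⟪u s x, a x⟫_ℝ) - ∫ x, ⟪v s x, a x⟫_ℝ := by
  rw [← integral_sub (Torus.integrable_inner_of_continuous ((hu.memLp s hs).integrable one_le_two) ha)
    (Torus.integrable_inner_of_continuous ((hv.memLp s hs).integrable one_le_two) ha)]
  exact integral_congr_ae (ae_of_all _ fun x => inner_sub_left _ _ _)

/-- The pairing `s ↦ ∫ ⟪u(s) - v(s), a⟫` is a.e.-strongly measurable, a.e. bounded and integrable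
on `(0, T)`. [folklore] -/
theorem Torus.IsLerayHopfOn.pairing_sub_bdd (hu : Torus.IsLerayHopfOn T ν f u₀ u)
    (hv : Torus.IsLerayHopfOn T ν f u₀ v) {a : UnitAddTorus d → EuclideanSpace ℝ d} (ha : Continuous a) :
    AEStronglyMeasurable (fun s => ∫ x, ⟪u s x - v s x, a x⟫_ℝ) (volume.restrict (Ioo 0 T)) ∧
      (∃ K : ℝ, ∀ᵐ s ∂(volume.restrict (Ioo 0 T)), ‖∫ x, ⟪u s x - v s x, a x⟫_ℝ‖ ≤ K) ∧
      IntegrableOn (fun s => ∫ x, ⟪u s x - v s x, a x⟫_ℝ) (Ioo 0 T) := by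
  have heq : ∀ᵐ s ∂(volume.restrict (Ioo 0 T)),
      (∫ x, ⟪u s x, a x⟫_ℝ) - (∫ x, ⟪v s x, a x⟫_ℝ) = ∫ x, ⟪u s x - v s x, a x⟫_ℝ := by
    filter_upwards [ae_restrict_mem measurableSet_Ioo] with s hsI
    exact (hu.integral_inner_sub_left_eq hv ha (Ioo_subset_Icc_self hsI)).symm
  refine ⟨((hu.aestronglyMeasurable_integral_inner ha).sub (hv.aestronglyMeasurable_integral_inner ha)).congr heq,
    ?_, ((hu.integrableOn_integral_inner ha).sub (hv.integrableOn_integral_inner ha)).congr heq⟩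
  obtain ⟨Ku, hKu⟩ := hu.exists_ae_abs_integral_inner_le ha
  obtain ⟨Kv, hKv⟩ := hv.exists_ae_abs_integral_inner_le ha
  refine ⟨Ku + Kv, ?_⟩
  filter_upwards [hKu, hKv, ae_restrict_mem measurableSet_Ioo] with s hsu hsv hsI
  rw [Real.norm_eq_abs, hu.integral_inner_sub_left_eq hv ha (Ioo_subset_Icc_self hsI)]
  exact (abs_sub _ _).trans (add_le_add hsu hsv)

/-- The squared pairing `s ↦ (∫ ⟪u(s) - v(s), a⟫)²` is integrable on `(0, T)`. [folklore] -/
theorem Torus.IsLerayHopfOn.integrableOn_sq_pairing_sub (hu : Torus.IsLerayHopfOn T ν f u₀ u)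
    (hv : Torus.IsLerayHopfOn T ν f u₀ v) {a : UnitAddTorus d → EuclideanSpace ℝ d} (ha : Continuous a) :
    IntegrableOn (fun s => (∫ x, ⟪u s x - v s x, a x⟫_ℝ) ^ 2) (Ioo 0 T) := by
  obtain ⟨hm, ⟨K, hK⟩, hi⟩ := hu.pairing_sub_bdd hv ha
  exact (hi.bdd_mul hm hK).congr (ae_of_all _ fun s => by ring)

/-- The product of the trilinear slice difference with the pairing,
`s ↦ (∫⟪u,(u·∇)Ψ⟫ - ∫⟪v,(v·∇)Ψ⟫)(∫ ⟪u - v, a⟫)`, is integrable on `(0, T)`. [folklore] -/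
theorem Torus.IsLerayHopfOn.integrableOn_convect_sub_mul_pairing_sub (hu : Torus.IsLerayHopfOn T ν f u₀ u)
    (hv : Torus.IsLerayHopfOn T ν f u₀ v) {Ψ : UnitAddTorus d → EuclideanSpace ℝ d} (hΨ : Torus.IsSmooth Ψ)
    {a : UnitAddTorus d → EuclideanSpace ℝ d} (ha : Continuous a) :
    IntegrableOn (fun s => ((∫ x, ⟪u s x, Torus.convect (u s) Ψ x⟫_ℝ) -
        ∫ x, ⟪v s x, Torus.convect (v s) Ψ x⟫_ℝ) * ∫ x, ⟪u s x - v s x, a x⟫_ℝ) (Ioo 0 T) := by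
  obtain ⟨hm, ⟨K, hK⟩, -⟩ := hu.pairing_sub_bdd hv ha
  have hNi : IntegrableOn (fun s => (∫ x, ⟪u s x, Torus.convect (u s) Ψ x⟫_ℝ) -
      ∫ x, ⟪v s x, Torus.convect (v s) Ψ x⟫_ℝ) (Ioo 0 T) :=
    (hu.integrableOn_integral_inner_convect hΨ).sub (hv.integrableOn_integral_inner_convect hΨ)
  exact (hNi.bdd_mul hm hK).congr (ae_of_all _ fun s => by ring)

/-! ### The energy balance of the difference, mode by mode -/

/-- **The balance of one frame coordinate of `w = u - v`.** For two Leray–Hopf solutions with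
the same data on `T^d × [0,T)`, a frame field `g = g_{kjc}` (`k ≠ 0`, `Δg = -λg`, `λ = 4π²|k|²`)
and `t ∈ (0, T]`:
`(w(t), g)² + 2νλ ∫₀ᵗ (w, g)² = 2 ∫₀ᵗ [∫⟪u,(u·∇)g⟫ - ∫⟪v,(v·∇)g⟫] (w, g)`
— the two time-sliced weak formulations (`Torus.IsLerayHopfOn.integral_inner_eq_add_setIntegral`,
the force cancels in the difference) make `s ↦ (w(s), g)` an integral `∫₀ˢ G`, and
`V(t)² = 2∫₀ᵗ G V` (`sq_sub_sq_eq_setIntegral_of_sub_eq_setIntegral`; Temam 1984, Ch. III,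
Lemma 1.2). [cite: Temam1984, Ch. III §1 Lemma 1.2] -/
theorem Torus.IsLerayHopfOn.sq_frame_pairing_sub_eq (hu : Torus.IsLerayHopfOn T ν f u₀ u)
    (hv : Torus.IsLerayHopfOn T ν f u₀ v) (hT : 0 < T)
    (hfm : AEStronglyMeasurable (Torus.stLift f) (volume.restrict (Ioo 0 T ×ˢ univ)))
    (hf₂ : ∫⁻ t in Ioo 0 T, ∫⁻ x, ‖f t x‖ₑ ^ 2 < ⊤) {k : d → ℤ} (hk : k ≠ 0) (j : d) (c : Bool)
    {t : ℝ} (ht : t ∈ Ioc 0 T) :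
    (∫ x, ⟪u t x - v t x, Torus.frameField k j c x⟫_ℝ) ^ 2 +
        2 * ν * (4 * Real.pi ^ 2 * Torus.freqNormSq k) *
          ∫ s in Ioc 0 t, (∫ x, ⟪u s x - v s x, Torus.frameField k j c x⟫_ℝ) ^ 2 =
      2 * ∫ s in Ioc 0 t, ((∫ x, ⟪u s x, Torus.convect (u s) (Torus.frameField k j c) x⟫_ℝ) -
          ∫ x, ⟪v s x, Torus.convect (v s) (Torus.frameField k j c) x⟫_ℝ) *
        ∫ x, ⟪u s x - v s x, Torus.frameField k j c x⟫_ℝ := by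
  set g := Torus.frameField k j c with hg
  set lam : ℝ := 4 * Real.pi ^ 2 * Torus.freqNormSq k with hlam
  have hgs : Torus.IsSmooth g := Torus.isSmooth_frameField k j c
  have hgd : Torus.IsDivFree g := Torus.isDivFree_frameField hk j c
  -- the fluxes and their difference
  set Fu : ℝ → ℝ := fun s => ∫ x, (⟪u s x, Torus.convect (u s) g x⟫_ℝ + ν * ⟪u s x, Torus.laplacian g x⟫_ℝ + ⟪f s x, g x⟫_ℝ) with hFu
  set Fv : ℝ → ℝ := fun s => ∫ x, (⟪v s x, Torus.convect (v s) g x⟫_ℝ + ν * ⟪v s x, Torus.laplacian g x⟫_ℝ + ⟪f s x, g x⟫_ℝ) with hFv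
  have hFui : IntegrableOn Fu (Ioo 0 T) := hu.integrableOn_flux hfm hf₂ hgs
  have hFvi : IntegrableOn Fv (Ioo 0 T) := hv.integrableOn_flux hfm hf₂ hgs
  set G : ℝ → ℝ := fun s => Fu s - Fv s with hG
  have hGi : IntegrableOn G (Ioo 0 T) := hFui.sub hFvi
  -- the pairing of `w` with `g` and its integral representation
  set P : ℝ → ℝ := fun s => ∫ x, ⟪u s x - v s x, g x⟫_ℝ with hP
  have hPuv : ∀ s ∈ Icc 0 T, P s = (∫ x, ⟪u s x, g x⟫_ℝ) - ∫ x, ⟪v s x, g x⟫_ℝ := fun s hs =>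
    hu.integral_inner_sub_left_eq hv hgs.continuous hs
  have hPV : ∀ τ ∈ Ioc 0 T, P τ = ∫ s in Ioc 0 τ, G s := by
    intro τ hτ
    rw [hPuv τ (Ioc_subset_Icc_self hτ), hu.integral_inner_eq_add_setIntegral hT hfm hf₂ hgs hgd hτ,
      hv.integral_inner_eq_add_setIntegral hT hfm hf₂ hgs hgd hτ, hG]
    rw [integral_sub (integrableOn_Ioc_of_integrableOn_Ioo hFui hτ.2) (integrableOn_Ioc_of_integrableOn_Ioo hFvi hτ.2)]
    ring
  -- the square of an integral
  set V : ℝ → ℝ := fun τ => ∫ s in Ioc 0 τ, G s with hV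
  have hV0 : V 0 = 0 := by rw [hV]; simp
  have hsq := sq_sub_sq_eq_setIntegral_of_sub_eq_setIntegral (V := V) (G := G) ht.1.le
    (integrableOn_Ioc_of_integrableOn_Ioo hGi ht.2) (fun τ _ => by rw [hV0, sub_zero])
  rw [hV0, zero_pow two_ne_zero, sub_zero] at hsq
  have hVt : V t = P t := (hPV t ht).symm
  have hVP : ∀ s ∈ Ioc 0 t, G s * V s = G s * P s := fun s hs => by
    rw [hPV s ⟨hs.1, hs.2.trans ht.2⟩]
  rw [hVt, setIntegral_congr_fun measurableSet_Ioc hVP] at hsq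
  -- the flux difference against the eigenfield: `G = (N_u - N_v) - νλ P` a.e.
  have hlap : ∀ {a : UnitAddTorus d → EuclideanSpace ℝ d}, Integrable a volume →
      ∫ x, ⟪a x, Torus.laplacian g x⟫_ℝ = -lam * ∫ x, ⟪a x, g x⟫_ℝ := by
    intro a ha
    rw [← integral_const_mul]
    refine integral_congr_ae (ae_of_all _ fun x => ?_)
    show ⟪a x, Torus.laplacian g x⟫_ℝ = -lam * ⟪a x, g x⟫_ℝ
    rw [hg, Torus.laplacian_frameField, inner_smul_right]
  have hGae : ∀ᵐ s ∂(volume.restrict (Ioo 0 T)), G s * P s =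
      ((∫ x, ⟪u s x, Torus.convect (u s) g x⟫_ℝ) - ∫ x, ⟪v s x, Torus.convect (v s) g x⟫_ℝ) * P s -
        ν * lam * P s ^ 2 := by
    filter_upwards [Torus.ae_integrable_force_slice hfm hf₂, ae_restrict_mem measurableSet_Ioo] with s hfs hsI
    have hus : MemLp (u s) 2 volume := hu.memLp s (Ioo_subset_Icc_self hsI)
    have hvs : MemLp (v s) 2 volume := hv.memLp s (Ioo_subset_Icc_self hsI)
    have hfg : Integrable (fun x => ⟪f s x, g x⟫_ℝ) volume := Torus.integrable_inner_of_continuous hfs hgs.continuous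
    have hsplit : ∀ {a : UnitAddTorus d → EuclideanSpace ℝ d}, MemLp a 2 volume →
        ∫ x, (⟪a x, Torus.convect a g x⟫_ℝ + ν * ⟪a x, Torus.laplacian g x⟫_ℝ + ⟪f s x, g x⟫_ℝ) =
          (∫ x, ⟪a x, Torus.convect a g x⟫_ℝ) - ν * lam * (∫ x, ⟪a x, g x⟫_ℝ) + ∫ x, ⟪f s x, g x⟫_ℝ := by
      intro a ha
      have h1 : Integrable (fun x => ⟪a x, Torus.convect a g x⟫_ℝ) volume := Torus.integrable_inner_convect_self ha hgs
      have h2 : Integrable (fun x => ν * ⟪a x, Torus.laplacian g x⟫_ℝ) volume :=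
        (Torus.integrable_inner_of_continuous (ha.integrable one_le_two) hgs.laplacian.continuous).const_mul ν
      have h12 : Integrable (fun x => ⟪a x, Torus.convect a g x⟫_ℝ + ν * ⟪a x, Torus.laplacian g x⟫_ℝ) volume := h1.add h2
      rw [integral_add h12 hfg, integral_add h1 h2, integral_const_mul, hlap (ha.integrable one_le_two)]
      ring
    have hGs : G s = ((∫ x, ⟪u s x, Torus.convect (u s) g x⟫_ℝ) - ∫ x, ⟪v s x, Torus.convect (v s) g x⟫_ℝ) -
        ν * lam * P s := by
      rw [hG]; dsimp only; rw [hFu, hFv]; dsimp only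
      rw [hsplit hus, hsplit hvs, hPuv s (Ioo_subset_Icc_self hsI)]
      ring
    rw [hGs]; ring
  -- transfer to `(0, t]` and integrate
  have hGae' : ∀ᵐ s ∂(volume.restrict (Ioc 0 t)), G s * P s =
      ((∫ x, ⟪u s x, Torus.convect (u s) g x⟫_ℝ) - ∫ x, ⟪v s x, Torus.convect (v s) g x⟫_ℝ) * P s -
        ν * lam * P s ^ 2 := by
    rw [← restrict_Ioo_eq_restrict_Ioc]
    exact ae_restrict_of_ae_restrict_of_subset (Ioo_subset_Ioo le_rfl ht.2) hGae
  rw [integral_congr_ae hGae'] at hsq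
  -- integrability of the two pieces on `(0, t]`
  have hI1t := integrableOn_Ioc_of_integrableOn_Ioo
    (hu.integrableOn_convect_sub_mul_pairing_sub hv hgs hgs.continuous) ht.2
  have hI2t := integrableOn_Ioc_of_integrableOn_Ioo (hu.integrableOn_sq_pairing_sub hv hgs.continuous) ht.2
  rw [integral_sub hI1t (hI2t.const_mul (ν * lam)), integral_const_mul] at hsq
  -- conclude
  have hPt : P t = ∫ x, ⟪u t x - v t x, g x⟫_ℝ := rfl
  rw [← hPt]
  linarith [hsq]

/-! ### The truncated energy balance of the difference -/

omit [DecidableEq d] in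
/-- Weak divergence-freeness is preserved under differences of integrable fields. [folklore] -/
theorem Torus.IsWeaklyDivFree.sub' {a b : UnitAddTorus d → EuclideanSpace ℝ d} (ha : Torus.IsWeaklyDivFree a)
    (hb : Torus.IsWeaklyDivFree b) (hai : Integrable a volume) (hbi : Integrable b volume) [DecidableEq d] :
    Torus.IsWeaklyDivFree (a - b) := by
  intro θ hθ
  have hc := hθ.gradient.continuous
  rw [show (fun x => ⟪(a - b) x, Torus.gradient θ x⟫_ℝ) = fun x => ⟪a x, Torus.gradient θ x⟫_ℝ - ⟪b x, Torus.gradient θ x⟫_ℝ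
    from funext fun x => by rw [Pi.sub_apply, inner_sub_left],
    integral_sub (Torus.integrable_inner_of_continuous hai hc) (Torus.integrable_inner_of_continuous hbi hc),
    ha θ hθ, hb θ hθ, sub_zero]

/-- The slice `w(t) = u(t) - v(t)`, `t ∈ (0, T]`, of the difference of two Leray–Hopf solutions
with the same data is in `L²`, weakly divergence free and has vanishing mean coefficient. [folklore] -/
theorem Torus.IsLerayHopfOn.slice_sub_admissible (hu : Torus.IsLerayHopfOn T ν f u₀ u)
    (hv : Torus.IsLerayHopfOn T ν f u₀ v) (hT : 0 < T)
    (hfm : AEStronglyMeasurable (Torus.stLift f) (volume.restrict (Ioo 0 T ×ˢ univ)))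
    (hf₂ : ∫⁻ t in Ioo 0 T, ∫⁻ x, ‖f t x‖ₑ ^ 2 < ⊤) {t : ℝ} (ht : t ∈ Ioc 0 T) :
    MemLp (u t - v t) 2 volume ∧ Torus.IsWeaklyDivFree (u t - v t) ∧
      mFourierCoeff (EuclideanSpace.complexify ∘ (u t - v t)) 0 = 0 := by
  have hut := hu.memLp t (Ioc_subset_Icc_self ht)
  have hvt := hv.memLp t (Ioc_subset_Icc_self ht)
  exact ⟨hut.sub hvt, Torus.IsWeaklyDivFree.sub' (hu.isWeaklyDivFree_of_mem_Ioc ht) (hv.isWeaklyDivFree_of_mem_Ioc ht)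
    (hut.integrable one_le_two) (hvt.integrable one_le_two),
    hu.mFourierCoeff_zero_sub_eq_zero hv hT hfm hf₂ ht⟩

/-- Linearity of `Ψ ↦ ∫ ⟪a, (a·∇)Ψ⟫` over frame sums `∑ₖ ∑ⱼ ∑_c c_{kjc} g_{kjc}`. [folklore] -/
theorem Torus.integral_inner_convect_frame_sum {a : UnitAddTorus d → EuclideanSpace ℝ d} (ha : MemLp a 2 volume)
    (S : Finset (d → ℤ)) (coef : (d → ℤ) → d → Bool → ℝ) :
    ∫ x, ⟪a x, Torus.convect a (fun y => ∑ k ∈ S, ∑ j, ∑ c, coef k j c • Torus.frameField k j c y) x⟫_ℝ =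
      ∑ k ∈ S, ∑ j, ∑ c, coef k j c * ∫ x, ⟪a x, Torus.convect a (Torus.frameField k j c) x⟫_ℝ := by
  have hfun : (fun y => ∑ k ∈ S, ∑ j, ∑ c, coef k j c • Torus.frameField k j c y) =
      fun y => ∑ p ∈ S ×ˢ ((Finset.univ : Finset d) ×ˢ (Finset.univ : Finset Bool)),
        coef p.1 p.2.1 p.2.2 • Torus.frameField p.1 p.2.1 p.2.2 y := by
    funext y
    rw [Finset.sum_product]
    refine Finset.sum_congr rfl fun k _ => ?_
    rw [Finset.sum_product]
  rw [hfun, Torus.integral_inner_convect_sum_smul _ ha (fun p => Torus.isSmooth_frameField _ _ _), Finset.sum_product]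
  refine Finset.sum_congr rfl fun k _ => ?_
  rw [Finset.sum_product]

/-- **The truncated energy balance of the difference of two Leray–Hopf solutions** (the
Galerkin-level form of Constantin–Foias 1988, (10.5) / Temam 1984, Ch. III (3.51) integrated in
time, `w = u - v`, `P_N` the Fourier truncation):
`∫ ‖P_N w(t)‖² + 2ν ∫₀ᵗ ‖∇P_N w‖₂² = 2 ∫₀ᵗ [∫⟪u,(u·∇)P_N w⟫ - ∫⟪v,(v·∇)P_N w⟫]`
for every `t ∈ (0, T]` and every `N` — the sum over the frame `g_{kjc}`, `0 < |k| ≤ N`, of the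
coordinate balances `Torus.IsLerayHopfOn.sq_frame_pairing_sub_eq`, using the frame Parseval
identities and the linearity of `Ψ ↦ ∫⟪a,(a·∇)Ψ⟫`. [cite: ConstantinFoias1988, Thm. 10.1 (proof, (10.3)–(10.5))] -/
theorem Torus.IsLerayHopfOn.truncated_difference_balance (hu : Torus.IsLerayHopfOn T ν f u₀ u)
    (hv : Torus.IsLerayHopfOn T ν f u₀ v) (hT : 0 < T)
    (hfm : AEStronglyMeasurable (Torus.stLift f) (volume.restrict (Ioo 0 T ×ˢ univ)))
    (hf₂ : ∫⁻ t in Ioo 0 T, ∫⁻ x, ‖f t x‖ₑ ^ 2 < ⊤) (N : ℕ) {t : ℝ} (ht : t ∈ Ioc 0 T) :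
    (∫ x, ‖Torus.fourierTruncate N (u t - v t) x‖ ^ 2) +
        2 * ν * ∫ s in Ioc 0 t, (Torus.eGradNormSq (Torus.fourierTruncate N (u s - v s))).toReal =
      2 * ∫ s in Ioc 0 t, ((∫ x, ⟪u s x, Torus.convect (u s) (Torus.fourierTruncate N (u s - v s)) x⟫_ℝ) -
          ∫ x, ⟪v s x, Torus.convect (v s) (Torus.fourierTruncate N (u s - v s)) x⟫_ℝ) := by
  -- notation
  set S := Torus.freqBall₀ (d := d) N with hS
  have hk0 : ∀ k ∈ S, k ≠ 0 := fun k hk => (Finset.mem_erase.1 hk).1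
  set P : (d → ℤ) → d → Bool → ℝ → ℝ := fun k j c s => ∫ x, ⟪u s x - v s x, Torus.frameField k j c x⟫_ℝ with hP
  set Nu : (d → ℤ) → d → Bool → ℝ → ℝ := fun k j c s => ∫ x, ⟪u s x, Torus.convect (u s) (Torus.frameField k j c) x⟫_ℝ with hNu
  set Nv : (d → ℤ) → d → Bool → ℝ → ℝ := fun k j c s => ∫ x, ⟪v s x, Torus.convect (v s) (Torus.frameField k j c) x⟫_ℝ with hNv
  have hgs : ∀ k j c, Torus.IsSmooth (Torus.frameField (d := d) k j c) := fun k j c => Torus.isSmooth_frameField k j c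
  -- the coordinate balances, summed
  have hmode : ∀ k ∈ S, ∀ j c, P k j c t ^ 2 + 2 * ν * (4 * Real.pi ^ 2 * Torus.freqNormSq k) * ∫ s in Ioc 0 t, P k j c s ^ 2 =
      2 * ∫ s in Ioc 0 t, (Nu k j c s - Nv k j c s) * P k j c s :=
    fun k hk j c => hu.sq_frame_pairing_sub_eq hv hT hfm hf₂ (hk0 k hk) j c ht
  have hsum : ∑ k ∈ S, ∑ j, ∑ c, (P k j c t ^ 2 + 2 * ν * (4 * Real.pi ^ 2 * Torus.freqNormSq k) * ∫ s in Ioc 0 t, P k j c s ^ 2) =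
      ∑ k ∈ S, ∑ j, ∑ c, 2 * ∫ s in Ioc 0 t, (Nu k j c s - Nv k j c s) * P k j c s :=
    Finset.sum_congr rfl fun k hk => Finset.sum_congr rfl fun j _ => Finset.sum_congr rfl fun c _ => hmode k hk j c
  -- admissibility of the slices of `w`
  have hadm : ∀ s ∈ Ioc 0 T, MemLp (u s - v s) 2 volume ∧ Torus.IsWeaklyDivFree (u s - v s) ∧
      mFourierCoeff (EuclideanSpace.complexify ∘ (u s - v s)) 0 = 0 := fun s hs => hu.slice_sub_admissible hv hT hfm hf₂ hs
  -- integrability on `(0, t]`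
  have hI2 : ∀ k j c, IntegrableOn (fun s => P k j c s ^ 2) (Ioc 0 t) := fun k j c =>
    integrableOn_Ioc_of_integrableOn_Ioo (hu.integrableOn_sq_pairing_sub hv (hgs k j c).continuous) ht.2
  have hI1 : ∀ k j c, IntegrableOn (fun s => (Nu k j c s - Nv k j c s) * P k j c s) (Ioc 0 t) := fun k j c =>
    integrableOn_Ioc_of_integrableOn_Ioo (hu.integrableOn_convect_sub_mul_pairing_sub hv (hgs k j c) (hgs k j c).continuous) ht.2
  -- LHS, first sum: Parseval at time `t`
  have hL1 : ∑ k ∈ S, ∑ j, ∑ c, P k j c t ^ 2 = ∫ x, ‖Torus.fourierTruncate N (u t - v t) x‖ ^ 2 := by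
    obtain ⟨hm, hd, h0⟩ := hadm t ht
    exact Torus.sum_frame_sq_eq hm hd h0 N
  -- LHS, second sum: weighted Parseval under the time integral
  have hL2 : ∑ k ∈ S, ∑ j, ∑ c, 2 * ν * (4 * Real.pi ^ 2 * Torus.freqNormSq k) * ∫ s in Ioc 0 t, P k j c s ^ 2 =
      2 * ν * ∫ s in Ioc 0 t, (Torus.eGradNormSq (Torus.fourierTruncate N (u s - v s))).toReal := by
    have h1 : ∀ k j c, 2 * ν * (4 * Real.pi ^ 2 * Torus.freqNormSq k) * ∫ s in Ioc 0 t, P k j c s ^ 2 =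
        2 * ν * ∫ s in Ioc 0 t, 4 * Real.pi ^ 2 * Torus.freqNormSq k * P k j c s ^ 2 := fun k j c => by
      rw [integral_const_mul]; ring
    simp_rw [h1, ← Finset.mul_sum]
    congr 1
    have hR : ∫ s in Ioc 0 t, (Torus.eGradNormSq (Torus.fourierTruncate N (u s - v s))).toReal =
        ∫ s in Ioc 0 t, ∑ k ∈ S, ∑ j, ∑ c, 4 * Real.pi ^ 2 * Torus.freqNormSq k * P k j c s ^ 2 := by
      refine setIntegral_congr_fun measurableSet_Ioc fun s hs => ?_
      obtain ⟨hm, hd, h0⟩ := hadm s ⟨hs.1, hs.2.trans ht.2⟩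
      exact (Torus.sum_frame_weighted_sq_eq hm hd h0 N).symm
    rw [hR, integral_finsetSum _ fun k _ => integrable_finsetSum _ fun j _ =>
      integrable_finsetSum _ fun c _ => (hI2 k j c).const_mul _]
    refine Finset.sum_congr rfl fun k _ => ?_
    rw [integral_finsetSum _ fun j _ => integrable_finsetSum _ fun c _ => (hI2 k j c).const_mul _]
    refine Finset.sum_congr rfl fun j _ => ?_
    rw [integral_finsetSum _ fun c _ => (hI2 k j c).const_mul _]
  -- RHS: the trilinear terms against the reconstructed truncation
  have hR1 : ∑ k ∈ S, ∑ j, ∑ c, 2 * ∫ s in Ioc 0 t, (Nu k j c s - Nv k j c s) * P k j c s =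
      2 * ∫ s in Ioc 0 t, ((∫ x, ⟪u s x, Torus.convect (u s) (Torus.fourierTruncate N (u s - v s)) x⟫_ℝ) -
          ∫ x, ⟪v s x, Torus.convect (v s) (Torus.fourierTruncate N (u s - v s)) x⟫_ℝ) := by
    simp_rw [← Finset.mul_sum]
    congr 1
    have hR : ∫ s in Ioc 0 t, ((∫ x, ⟪u s x, Torus.convect (u s) (Torus.fourierTruncate N (u s - v s)) x⟫_ℝ) -
          ∫ x, ⟪v s x, Torus.convect (v s) (Torus.fourierTruncate N (u s - v s)) x⟫_ℝ) =
        ∫ s in Ioc 0 t, ∑ k ∈ S, ∑ j, ∑ c, (Nu k j c s - Nv k j c s) * P k j c s := by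
      refine setIntegral_congr_fun measurableSet_Ioc fun s hs => ?_
      have hs' : s ∈ Ioc 0 T := ⟨hs.1, hs.2.trans ht.2⟩
      obtain ⟨hm, hd, h0⟩ := hadm s hs'
      have hus : MemLp (u s) 2 volume := hu.memLp s (Ioc_subset_Icc_self hs')
      have hvs : MemLp (v s) 2 volume := hv.memLp s (Ioc_subset_Icc_self hs')
      have hrec : (fun y => ∑ k ∈ S, ∑ j, ∑ c, P k j c s • Torus.frameField k j c y) =
          Torus.fourierTruncate N (u s - v s) :=
        funext fun y => Torus.sum_frame_smul_eq_fourierTruncate hm hd h0 N y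
      rw [← hrec, Torus.integral_inner_convect_frame_sum hus, Torus.integral_inner_convect_frame_sum hvs,
        ← Finset.sum_sub_distrib]
      refine Finset.sum_congr rfl fun k _ => ?_
      rw [← Finset.sum_sub_distrib]
      refine Finset.sum_congr rfl fun j _ => ?_
      rw [← Finset.sum_sub_distrib]
      refine Finset.sum_congr rfl fun c _ => ?_
      ring
    rw [hR, integral_finsetSum _ fun k _ => integrable_finsetSum _ fun j _ =>
      integrable_finsetSum _ fun c _ => hI1 k j c]
    refine Finset.sum_congr rfl fun k _ => ?_
    rw [integral_finsetSum _ fun j _ => integrable_finsetSum _ fun c _ => hI1 k j c]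
    refine Finset.sum_congr rfl fun j _ => ?_
    rw [integral_finsetSum _ fun c _ => hI1 k j c]
  -- assemble
  have hsplit : ∑ k ∈ S, ∑ j, ∑ c, (P k j c t ^ 2 + 2 * ν * (4 * Real.pi ^ 2 * Torus.freqNormSq k) * ∫ s in Ioc 0 t, P k j c s ^ 2) =
      (∑ k ∈ S, ∑ j, ∑ c, P k j c t ^ 2) +
        ∑ k ∈ S, ∑ j, ∑ c, 2 * ν * (4 * Real.pi ^ 2 * Torus.freqNormSq k) * ∫ s in Ioc 0 t, P k j c s ^ 2 := by
    simp_rw [Finset.sum_add_distrib]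
  rw [hsplit, hL1, hL2, hR1] at hsum
  exact hsum

end Literature.Analysis.FluidPDE

end
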